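import Summits.HodgeConjecture.HodgeConjecture.Theses.GenericDivisibility
import Summits.HodgeConjecture.HodgeConjecture.Theorems.GenericDivisibilityHodgeModelsExist
import Summits.HodgeConjecture.HodgeConjecture.Theorems.GenericDivisibilityHodgeClassesGenericallyDivisibleFinite
import Literature.AlgebraicGeometry.Motives.VarietiesUnitProofs
import Literature.AlgebraicTopology.SingularHomology.CohomologyOfPoint
import Literature.AlgebraicTopology.SingularHomology.CupProduct

/-!
# `HodgeClassesGenericallyDivisible` (C1, stmt-HodgeConjecture-18466) · Negative · load-bearing hypotheses

Negative knowledge for the crux `GenericDivisibility.HodgeClassesGenericallyDivisible` (route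
GenericDivisibility, rank 2), extracted from the standing disprover's work file
`Cruxes/HodgeClassesGenericallyDivisible/Disproof.lean` (§(a) load-bearing analysis, §ceiling):

* CEILING (`not_hodgeConjecture_of_not_hodgeClassesGenericallyDivisible`). The provers' landed
  `hodgeClassesGenericallyDivisible_of_hodgeConjecture_of_facts` says Dimca 1992 Cor. (6.10) ∧
  Colliot-Thélène–Voisin 2012 Thm 3.1 ∧ HC ⟹ C1; contrapositively every refutation of C1 refutes the
  Hodge conjecture granted two theorems in print.  So no `_refuted` theorem for this crux exists short
  of a counterexample to the summit, detected at finite coefficients.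
* `1 ≤ p` IS LOAD-BEARING (`hodgeClassesGenericallyDivisible_false_without_hp`): with the binder
  `1 ≤ p` deleted the statement is false at `p = 0`, `X = Spec ℂ`, `z = 1 ∈ H⁰(pt; ℤ) = ℤ`, `m = 2`
  (every degree-`0` class is of type `(0,0)`, `isOfHodgeType_deg_zero`; the only proper closed subset
  of the one-point scheme is `∅`, and `1` is odd).
* `Z ≠ univ` IS THE ONLY CONTENT GUARD (`hodgeClassesGenericallyDivisible_withoutNeUniv`): with it
  deleted the statement holds for the junk witness `Z = X`, `(X ∖ X)(ℂ) = ∅`, `y = 0`, using none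
  of the hypotheses.
* `1 ≤ m` IS NOT LOAD-BEARING FOR TRUTH (`hodgeClassesGenericallyDivisible_withoutHm_iff`): deleting
  it adds exactly the instance `m = 0`, i.e. "every integral middle `(p,p)` class dies integrally on a
  non-empty Zariski open" (generic vanishing, the census's S⁺₁ with `N = 1`), which is implied by the
  Hodge conjecture for the same `X` (`genericDivisibility_exists_restrict_eq_zero_of_hodgeConjectureFor`)
  — so no `_false_without_hm` can exist unless HC fails; the binder only keeps C1 weaker than HC.
* The Hodge-type hypothesis is load-bearing ON PAPER (no tree witness): at `p = 1` the statement
  without `IsOfHodgeType` says every `z ∈ H²(S(ℂ); ℤ)` is `≡` a divisor class mod every `m`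
  (`N¹H²(S; ℤ/m) = NS(S)/m`, Kummer + purity for curves), i.e. `NS(S) = H²(S; ℤ)`, false for every
  surface with `p_g > 0` (K3, abelian); the tree has no surface with computed `H² ⊋ NS`, so this is
  recorded in the work file only.
Refuter seat refuter-cdisprove-stmt-HodgeConjecture-18466-0 (cdisprove cycle 1), 2026-08-17.
-/

noncomputable section

-- The mandated namespace `Summit.<P>.<Sub>.Theorems.…` repeats `HodgeConjecture` (single-conjunct summit).
set_option linter.dupNamespace false

namespace Summit.HodgeConjecture.HodgeConjecture.Theorems.HodgeClassesGenericallyDivisible.Negative.LoadBearing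

open CategoryTheory AlgebraicGeometry MonoidalCategory CartesianMonoidalCategory
open Literature.AlgebraicGeometry.Motives Literature.AlgebraicGeometry.HodgeTheory
  Literature.AlgebraicTopology.SingularHomology
open Summit.HodgeConjecture.HodgeConjecture.Theses.GenericDivisibility (HodgeClassesGenericallyDivisible)

/-! ### Ceiling: the crux is implied by the Hodge conjecture -/

/-- **`¬ C1 → ¬ HodgeConjecture`, granted Dimca 1992 Cor. (6.10) and Colliot-Thélène–Voisin 2012
Thm 3.1** (the two printed theorems vendored as named facts and consumed by the provers'
`hodgeClassesGenericallyDivisible_of_hodgeConjecture_of_facts`): a witness against the crux is a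
counterexample to the Hodge conjecture seen at finite level. [cite: ColliotTheleneVoisin2012, Thm 3.1]
[cite: Dimca1992, Ch. 1 Cor. (6.10)] -/
theorem not_hodgeConjecture_of_not_hodgeClassesGenericallyDivisible
    (hfin : Dimca1992_finite_singularHomology_complexPointsCompl)
    (hT : ColliotTheleneVoisin2012_torsionDiesGenerically)
    (h : ¬ HodgeClassesGenericallyDivisible) : ¬ _root_.HodgeConjecture :=
  fun hHC ↦ h (hodgeClassesGenericallyDivisible_of_hodgeConjecture_of_facts hfin hT hHC)

/-! ### `1 ≤ p` is load-bearing: the point `Spec ℂ` -/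

/-- **In degree `0` every class is of Hodge type `(0,0)`** in any Hodge model: the Hodge
decomposition field `isInternal_hodgePQ 0` has the single summand indexed by the antidiagonal
`{(0,0)}` of `0`, so `H^{0,0}_dR = H⁰_dR`, whose image under the de Rham comparison is all of `H⁰`.
[cite: VoisinHodgeI2002, §6.1 and §7.1.1] -/
theorem isOfHodgeType_deg_zero {n : ℕ} {X : SchemeOver ℂ} (A : HodgeModel n X)
    (c : singularCohomology ℂ ℂ (ComplexPoints X) 0) : IsOfHodgeType n X 0 0 0 c := by
  refine ⟨A, ?_⟩
  have htop : Literature.NumberTheory.Transcendental.hodgePQ A.model A.carrier 0 0 0 = ⊤ := by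
    have h := (A.isInternal_hodgePQ 0).submodule_iSup_eq_top
    refine eq_top_iff.2 (h ▸ iSup_le fun i ↦ ?_)
    obtain ⟨⟨a, b⟩, hab⟩ := i
    have hab' : a + b = 0 := Finset.HasAntidiagonal.mem_antidiagonal.1 hab
    obtain ⟨rfl, rfl⟩ : a = 0 ∧ b = 0 := ⟨by omega, by omega⟩
    exact le_rfl
  have hA : A.hodgePQ 0 0 0 = ⊤ := by
    rw [HodgeModel.hodgePQ, htop, Submodule.map_top]
    exact LinearEquiv.range (A.deRham A.carrier 0)
  rw [hA]
  exact Submodule.mem_top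

/-- `ε(1) = 1` for the evaluation `ε : H⁰(U; ℤ) ≃ ℤ` of a path-connected space `U`.
[cite: HatcherAT2002, §3.1 p. 199] -/
theorem zeroEquiv_one {U : Type} [TopologicalSpace U] [PathConnectedSpace U] :
    singularCohomologyZeroEquiv ℤ ℤ U (singularCohomology.one ℤ U) = 1 := by
  rw [singularCohomology.one, singularCohomologyZeroEquiv_π,
    singularCochainComplex.cocyclesZeroEquiv_apply, singularCochainComplex.iCocycles_mk]
  rfl

/-- **The crux WITHOUT `1 ≤ p` is false.** The statement below is `HodgeClassesGenericallyDivisible`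
with the binder `1 ≤ p` deleted (everything else verbatim).  Witness: `p = 0`,
`X = Spec ℂ = 𝟙_ (SchemeOver ℂ)` (smooth projective of dimension `0`, `isSmoothProjective_unit_holds`),
`z = 1 ∈ H⁰(X(ℂ); ℤ)` (of type `(0,0)` in the Hodge model of `genericDivisibility_hodgeModelsExist_proof`,
`isOfHodgeType_deg_zero`), `m = 2`: `Spec ℂ` has one point, so `Z ≠ univ` keeps the unique complex
point in `(X ∖ Z)(ℂ)`, a one-point space with `H⁰ = ℤ · 1` (`singularCohomologyZeroEquiv`), and
`2 • y = 1` has no solution in `ℤ`.  So any proof of C1 must use `1 ≤ p`. [cite: HatcherAT2002, §3.1 p. 199] -/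
theorem hodgeClassesGenericallyDivisible_false_without_hp :
    ¬ (∀ ⦃p : ℕ⦄ ⦃X : SchemeOver ℂ⦄, IsSmoothProjective (2 * p) X →
        ∀ z : singularCohomology ℤ ℤ (ComplexPoints X) (2 * p),
          IsOfHodgeType (2 * p) X (2 * p) p p
            (singularCohomology.ringChange (Int.castRingHom ℂ) (ComplexPoints X) (2 * p) z) →
          ∀ m : ℕ, 1 ≤ m → ∃ Z : Set X.left, IsClosed Z ∧ Z ≠ Set.univ ∧
            ∃ y : singularCohomology ℤ ℤ (complexPointsCompl X Z) (2 * p),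
              m • y = singularCohomology.map ℤ ℤ
                (⟨Subtype.val, continuous_subtype_val⟩ :
                  C(complexPointsCompl X Z, ComplexPoints X)) (2 * p) z) := by
  intro h
  have hX : IsSmoothProjective (2 * 0) (𝟙_ (SchemeOver ℂ)) := isSmoothProjective_unit_holds ℂ
  obtain ⟨A⟩ := genericDivisibility_hodgeModelsExist_proof (2 * 0) _ hX
  have hz : IsOfHodgeType (2 * 0) (𝟙_ (SchemeOver ℂ)) (2 * 0) 0 0
      (singularCohomology.ringChange (Int.castRingHom ℂ) (ComplexPoints (𝟙_ (SchemeOver ℂ)))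
        (2 * 0) (singularCohomology.one ℤ (ComplexPoints (𝟙_ (SchemeOver ℂ))))) :=
    isOfHodgeType_deg_zero A _
  obtain ⟨Z, -, hZ, y, hy⟩ :=
    h hX (singularCohomology.one ℤ (ComplexPoints (𝟙_ (SchemeOver ℂ)))) hz 2 (by norm_num)
  -- `Spec ℂ` has one point, so `Z ≠ univ` forces the unique complex point off `Z`
  haveI : Subsingleton ↥((𝟙_ (SchemeOver ℂ)).left) :=
    inferInstanceAs (Subsingleton (PrimeSpectrum ℂ))
  let P₀ : ComplexPoints (𝟙_ (SchemeOver ℂ)) := toUnit _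
  have hP₀ : P₀.pt ∉ Z := fun hP ↦
    hZ (Set.eq_univ_of_forall fun x ↦ (Subsingleton.elim P₀.pt x) ▸ hP)
  haveI : PathConnectedSpace (complexPointsCompl (𝟙_ (SchemeOver ℂ)) Z) :=
    ⟨⟨⟨P₀, hP₀⟩⟩, fun x y ↦ by rw [Subsingleton.elim x y]⟩
  have key := congrArg (singularCohomologyZeroEquiv ℤ ℤ (complexPointsCompl (𝟙_ (SchemeOver ℂ)) Z)) hy
  have h1 : singularCohomology.map ℤ ℤ
      (⟨Subtype.val, continuous_subtype_val⟩ :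
        C(complexPointsCompl (𝟙_ (SchemeOver ℂ)) Z, ComplexPoints (𝟙_ (SchemeOver ℂ)))) 0
      (singularCohomology.one ℤ (ComplexPoints (𝟙_ (SchemeOver ℂ)))) =
      singularCohomology.one ℤ _ := singularCohomology.map_one _
  have h2 : singularCohomologyZeroEquiv ℤ ℤ (complexPointsCompl (𝟙_ (SchemeOver ℂ)) Z)
      (singularCohomology.map ℤ ℤ
        (⟨Subtype.val, continuous_subtype_val⟩ :
          C(complexPointsCompl (𝟙_ (SchemeOver ℂ)) Z, ComplexPoints (𝟙_ (SchemeOver ℂ)))) (2 * 0)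
        (singularCohomology.one ℤ (ComplexPoints (𝟙_ (SchemeOver ℂ))))) = 1 :=
    (congrArg _ h1).trans zeroEquiv_one
  rw [map_nsmul, h2, nsmul_eq_mul, Nat.cast_ofNat] at key
  omega

/-! ### The guard `Z ≠ Set.univ` is the only content guard (tightness of the conclusion) -/

/-- **The crux WITHOUT the guard `Z ≠ Set.univ` holds trivially.** The statement below is
`HodgeClassesGenericallyDivisible` with `Z ≠ Set.univ` deleted; it is witnessed by the junk `Z = X`:
`(X ∖ X)(ℂ) = ∅`, `H²ᵖ(∅; ℤ) = 0`, `y = 0` — no hypothesis is used.  (Informally: every integral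
class is divisible by everything on the empty open; the non-emptiness of `X ∖ Z` is where all the
content of C1 sits.) [cite: HatcherAT2002, §3.1] -/
theorem hodgeClassesGenericallyDivisible_withoutNeUniv :
    ∀ ⦃p : ℕ⦄ ⦃X : SchemeOver ℂ⦄, 1 ≤ p → IsSmoothProjective (2 * p) X →
      ∀ z : singularCohomology ℤ ℤ (ComplexPoints X) (2 * p),
        IsOfHodgeType (2 * p) X (2 * p) p p
          (singularCohomology.ringChange (Int.castRingHom ℂ) (ComplexPoints X) (2 * p) z) →
        ∀ m : ℕ, 1 ≤ m → ∃ Z : Set X.left, IsClosed Z ∧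
          ∃ y : singularCohomology ℤ ℤ (complexPointsCompl X Z) (2 * p),
            m • y = singularCohomology.map ℤ ℤ
              (⟨Subtype.val, continuous_subtype_val⟩ : C(complexPointsCompl X Z, ComplexPoints X))
              (2 * p) z := by
  intro p X _ _ z _ m _
  refine ⟨Set.univ, isClosed_univ, 0, ?_⟩
  haveI : IsEmpty (complexPointsCompl X Set.univ) := ⟨fun P ↦ P.2 (Set.mem_univ _)⟩
  haveI := ModuleCat.subsingleton_of_isZero
    (isZero_singularCohomology_of_isEmpty ℤ ℤ (E := complexPointsCompl X Set.univ) (2 * p))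
  exact Subsingleton.elim _ _

/-! ### `1 ≤ m` is not load-bearing for truth: dropping it gives generic vanishing -/

/-- **The crux WITHOUT `1 ≤ m` is exactly generic vanishing.** Left: `HodgeClassesGenericallyDivisible`
with the binder `1 ≤ m` deleted; right: every integral middle-degree class with `(p,p)`
complexification dies integrally on the complex points of some non-empty Zariski open (the census's
strengthening S⁺₁ with `N = 1`).  The instance `m = 0` of the left side reads `0 = z|`; conversely
`z| = 0 = m • 0` for every `m`.  The right side follows from `HodgeConjectureFor (2p) X` for the
same `X` (provers' `genericDivisibility_exists_restrict_eq_zero_of_hodgeConjectureFor`, granted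
CT–Voisin Thm 3.1 and finite generation), so the binder `1 ≤ m` cannot be shown load-bearing by a
counterexample short of refuting HC: it only makes C1 WEAKER than the Hodge conjecture in the
middle degree. [cite: ColliotTheleneVoisin2012, Thm 3.1] -/
theorem hodgeClassesGenericallyDivisible_withoutHm_iff :
    (∀ ⦃p : ℕ⦄ ⦃X : SchemeOver ℂ⦄, 1 ≤ p → IsSmoothProjective (2 * p) X →
      ∀ z : singularCohomology ℤ ℤ (ComplexPoints X) (2 * p),
        IsOfHodgeType (2 * p) X (2 * p) p p
          (singularCohomology.ringChange (Int.castRingHom ℂ) (ComplexPoints X) (2 * p) z) →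
        ∀ m : ℕ, ∃ Z : Set X.left, IsClosed Z ∧ Z ≠ Set.univ ∧
          ∃ y : singularCohomology ℤ ℤ (complexPointsCompl X Z) (2 * p),
            m • y = singularCohomology.map ℤ ℤ
              (⟨Subtype.val, continuous_subtype_val⟩ : C(complexPointsCompl X Z, ComplexPoints X))
              (2 * p) z) ↔
    (∀ ⦃p : ℕ⦄ ⦃X : SchemeOver ℂ⦄, 1 ≤ p → IsSmoothProjective (2 * p) X →
      ∀ z : singularCohomology ℤ ℤ (ComplexPoints X) (2 * p),
        IsOfHodgeType (2 * p) X (2 * p) p p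
          (singularCohomology.ringChange (Int.castRingHom ℂ) (ComplexPoints X) (2 * p) z) →
        ∃ Z : Set X.left, IsClosed Z ∧ Z ≠ Set.univ ∧
          singularCohomology.map ℤ ℤ
            (⟨Subtype.val, continuous_subtype_val⟩ : C(complexPointsCompl X Z, ComplexPoints X))
            (2 * p) z = 0) := by
  constructor
  · intro h p X hp hX z hz
    obtain ⟨Z, hZc, hZne, y, hy⟩ := h hp hX z hz 0
    exact ⟨Z, hZc, hZne, by rw [← hy, zero_smul]⟩
  · intro h p X hp hX z hz m
    obtain ⟨Z, hZc, hZne, h0⟩ := h hp hX z hz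
    exact ⟨Z, hZc, hZne, 0, by rw [smul_zero, h0]⟩

end Summit.HodgeConjecture.HodgeConjecture.Theorems.HodgeClassesGenericallyDivisible.Negative.LoadBearing

end
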